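import Summits.ResolutionOfSingularities.ResolutionOfSingularities.Theorems.FrobeniusClosingSteerMemberDerivationFrameEngine
import Literature.AlgebraicGeometry.Resolution.SmoothOfRegularFibre
import HarnessLib

/-!
# Crux `Steer` (stmt-ResolutionOfSingularities-16345), chain W4.1, hA3 Θ1♭ piece (L7), brick **(L7-Ω)**, part 3 of 3:
# the 𝔪-ADAPTED DERIVATION FRAME of a regular local ring essentially of finite type over a perfect field

OURS (campaign `res-hironaka`, rung L ★L-G4, slot W4.1; seat res-L0-w41-stub-4 g6 on res-D-pv-004 (AS res-L0-w41-
stub-10)'s split 2026-08-27T10:43:42Z «you take brick (L7-Ω) = step (a)»; replaces the role of no printed item; NOT a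
statement of the manuscript under review [claim: Hironaka2017, status: under-review]; AI-produced, weaker than expert
review). Theses-free and definition-free support for (L7) «members of the run have enough derivations»
(`Theorems/FrobeniusClosingSteerMemberDerivations.lean`, res-D-pv-004), the `K♭ v2.2` binder `H` of §σ2.26 v2.

## Statement (Matsumura Thm. 30.6 (ii) with the residue directions added; classical)

Let `k` be a perfect field of characteristic `p`, `S` a regular local ring essentially of finite type over `k`,
`𝔪 = (x₁, …, x_c)` a regular system of parameters (`c = emb dim S`), `κ = S/𝔪`. Then (`exists_frame`) there are

* `u₁, …, u_e ∈ S` whose residues `ū_j` form a **`p`-basis of `κ`** — `κ = κ^p(ū)`, spelled instance-free as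
  `Subfield.closure (range (· ^ p) ∪ range ū) = ⊤` (= the tree's `pAdjoin p (range ū) = ⊤`, `pAdjoin_eq_closure`) with
  DUAL derivations `δ_j ∈ Der_k(κ)`, `δ_j(ū_{j'}) = δ_{jj'}`, whose common kernel is
  exactly `κ^p` — and
* derivations `∂_{x_i}, ∂_{u_j} ∈ Der_k(S)` with the four δ-relations
  `∂_{x_i}(x_{i'}) = δ_{ii'}`, `∂_{x_i}(u_j) = 0`, `∂_{u_j}(x_i) = 0`, `∂_{u_j}(u_{j'}) = δ_{jj'}`

(so `∂_{u_j} 𝔪 ⊆ 𝔪`: the `u`-directions are LOGARITHMIC, `derivation_map_maximalIdeal_le`), for EVERY regular system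
of parameters `x`. `ℤ`-form (Matsumura's `Der(S)`, the currency of `H`): `exists_frame_int`; fully existential:
`exists_rsop_frame_int`. MODULAR FORM (the residue `p`-basis `u, δ` as INPUT, so that several conclusions refer to
the same frame): `exists_residue_pBasis` (such `u, δ` exist) · `exists_dual_derivations` (the four δ-relations) · in
part 2 (`FrobeniusClosingSteerMemberDerivationFrameBasis.lean`): `exists_kaehler_basis` (`dx ∪ du` is a BASIS of
`Ω_{S/k}`, free of rank `c + e`) and `derivation_eq_of_apply_eq_frame` (UNIQUENESS: two `k`-derivations of `S` into
ANY `S`-module — e.g. the completion — agreeing on the `x_i` and the `u_j` are equal).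

## Proof (ours; the engine is part 1, `FrobeniusClosingSteerMemberDerivationFrameEngine.lean`; basis/uniqueness part 2)

ENGINE (`MemberDerivationFrame.exists_retraction_sum`, any field `k`): for `A` local, essentially of finite type and formally smooth over
`k` with formally smooth residue field `K`, minimal generators `x : ι → 𝔪` and ANY `u : ι' → A` whose residues carry
dual `k`-derivations `δ` of `K`, the `A`-linear map `A^{ι ⊕ ι'} → Ω_{A/k}`, `e_l ↦ d(x,u)_l`, is SPLIT injective:
`Ω_{A/k}` is finite free over the local ring `A`, so it suffices that the fibre family
`{1 ⊗ dx_i} ∪ {1 ⊗ du_j} ⊂ K ⊗_A Ω_{A/k}` is linearly independent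
(`IsLocalRing.split_injective_iff_lTensor_residueField_injective`); the `x`-block is independent by the tree's
`exists_retraction_of_formallySmooth` (Jacobian criterion `K ⊗ 𝔪 ↪ K ⊗ Ω`), the `u`-block maps under
`K ⊗_A Ω_{A/k} → Ω_{K/k}` to `{dū_j}`, independent by the dual functionals `δ_j`, and that map KILLS the `x`-block
(`d x̄_i = d 0`), whence the two spans are disjoint. A retraction composed with the coordinate projections and the
universal derivation is the frame (`exists_frame_of_dual`). INPUT for `S`: regular + essentially of finite type over
perfect `k` ⇒ formally smooth (tree `formallySmooth_of_isRegularLocalRing_of_perfectField`, Stacks 00TV); `κ` is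
finitely generated over the perfect `k`, so a `p`-free subset of a finite generating set is a finite `p`-basis with
dual derivations (tree `PIndependentDerivations.lean`, `PBasisDual`), which are `k`-linear because derivations kill
`k = k^p` (`exists_derivation_of_int`).

[cite: Matsumura1987, §30 Thm. 30.6 (ii) p. 240; §26 p. 202 and Thm. 26.5] [cite: StacksProject, Tag 00TV] [folklore]
bears_on: LADDER-RESOLUTION L ★L-G4 W4.1 (crux `Steer`, hA3 (L7)).
-/

noncomputable section

-- `Summit.<S>.<S>.…` duplicates the summit name by design (single-problem summit).
set_option linter.dupNamespace false

open IsLocalRing TensorProduct KaehlerDifferential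

namespace Summit.ResolutionOfSingularities.ResolutionOfSingularities.Theorems.SwitchingDichotomy.MemberDerivationFrame

open Literature.AlgebraicGeometry.Resolution Literature.FieldTheory.Separability

universe u

/-! ## §3c The frame of a regular local ring essentially of finite type over a perfect field -/

section Frame

variable (p : ℕ) [Fact p.Prime]

/-- **Residue `p`-bases exist**: for `S` local, essentially of finite type over a perfect field `k` of
characteristic `p`, there are `u : Fin e → S` whose residues form a `p`-basis of the residue field `κ`
(`κ = κ^p(ū)`, instance-free spelling of the tree's `pAdjoin p (range ū) = ⊤`) with dual `k`-derivations
`δ_j ∈ Der_k(κ)` of common kernel exactly `κ^p`. [cite: Matsumura1987, §26 Thm. 26.5] [folklore] -/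
theorem exists_residue_pBasis (k S : Type u) [Field k] [CharP k p] [PerfectField k] [CommRing S] [IsLocalRing S]
    [Algebra k S] [Algebra.EssFiniteType k S] :
    ∃ (e : ℕ) (u : Fin e → S) (δ : Fin e → Derivation k (ResidueField S) (ResidueField S)),
      Subfield.closure (Set.range (fun y : ResidueField S => y ^ p) ∪ Set.range (fun j => residue S (u j))) = ⊤ ∧
      (∀ j j', δ j (residue S (u j')) = if j' = j then 1 else 0) ∧
      (∀ y : ResidueField S, (∀ j, δ j y = 0) ↔ ∃ t, t ^ p = y) := by
  set K := ResidueField S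
  haveI : CharP K p := charP_of_injective_algebraMap (algebraMap k K).injective p
  haveI : Algebra.EssFiniteType k K := inferInstanceAs (Algebra.EssFiniteType k (S ⧸ maximalIdeal S))
  obtain ⟨e, z, δ, hztop, hδ, hker⟩ := exists_pBasis_dual p (k := k) (K := K) (IntermediateField.fg_top k K)
  choose u hu using fun j => residue_surjective (R := S) (z j)
  have hzu : (fun j => residue S (u j)) = z := funext hu
  exact ⟨e, u, δ, by rw [hzu, ← pAdjoin_eq_closure p, hztop], fun j j' => by rw [hu, hδ], hker⟩

/-- **Dual derivations for a given frame** `(x, u)`: `S` regular local, essentially of finite type over a perfect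
field `k`, `x : Fin c → S` a regular system of parameters, `u : Fin e → S` with residues carrying dual
`k`-derivations of `κ`. Then there are `dx_i, du_j ∈ Der_k(S)` with the four δ-relations.
[cite: Matsumura1987, Thm. 30.6 (ii)] [cite: StacksProject, Tag 00TV] [folklore] -/
theorem exists_dual_derivations (k S : Type u) [Field k] [PerfectField k] [CommRing S] [IsRegularLocalRing S]
    [Algebra k S] [Algebra.EssFiniteType k S] {c e : ℕ} (hc : (maximalIdeal S).spanFinrank = c)
    (x : Fin c → S) (hx : Ideal.span (Set.range x) = maximalIdeal S) (u : Fin e → S)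
    (δ : Fin e → Derivation k (ResidueField S) (ResidueField S))
    (hδ : ∀ j j', δ j (residue S (u j')) = if j' = j then 1 else 0) :
    ∃ (dx : Fin c → Derivation k S S) (du : Fin e → Derivation k S S),
      (∀ i i', dx i (x i') = if i' = i then 1 else 0) ∧ (∀ i j, dx i (u j) = 0) ∧
      (∀ j i, du j (x i) = 0) ∧ (∀ j j', du j (u j') = if j' = j then 1 else 0) := by
  haveI : Algebra.FormallySmooth k S := formallySmooth_of_isRegularLocalRing_of_perfectField k S
  haveI : Algebra.FormallySmooth k (ResidueField S) :=
    formallySmooth_residueField_of_perfectField (k := k) (A := S)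
  obtain ⟨der, hder⟩ := exists_frame_of_dual (k := k) x hx (by rw [Fintype.card_fin, hc]) u δ hδ
  refine ⟨fun i => der (Sum.inl i), fun j => der (Sum.inr j), fun i i' => ?_, fun i j => ?_, fun j i => ?_,
    fun j j' => ?_⟩
  · simpa using hder (Sum.inl i) (Sum.inl i')
  · simpa using hder (Sum.inl i) (Sum.inr j)
  · simpa using hder (Sum.inr j) (Sum.inl i)
  · simpa using hder (Sum.inr j) (Sum.inr j')

/-- **THE 𝔪-ADAPTED DERIVATION FRAME (L7-Ω).** Let `k` be a perfect field of characteristic `p`, `S` a regular local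
ring essentially of finite type over `k`, and `x : Fin c → S` a regular system of parameters (`c = emb dim S`,
`(x) = 𝔪`). Then there are `u : Fin e → S` whose residues form a `p`-basis of `κ = S/𝔪` (`κ = κ^p(ū)`) with dual
derivations `δ_j ∈ Der_k(κ)` of common kernel exactly `κ^p`, and `k`-derivations `dx_i, du_j ∈ Der_k(S)` with
`dx_i (x_{i'}) = δ_{ii'}`, `dx_i (u_j) = 0`, `du_j (x_i) = 0`, `du_j (u_{j'}) = δ_{jj'}`.
[cite: Matsumura1987, Thm. 30.6 (ii); §26 Thm. 26.5] [cite: StacksProject, Tag 00TV] [folklore] -/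
theorem exists_frame (k S : Type u) [Field k] [CharP k p] [PerfectField k] [CommRing S] [IsRegularLocalRing S]
    [Algebra k S] [Algebra.EssFiniteType k S] {c : ℕ} (hc : (maximalIdeal S).spanFinrank = c)
    (x : Fin c → S) (hx : Ideal.span (Set.range x) = maximalIdeal S) :
    ∃ (e : ℕ) (u : Fin e → S) (δ : Fin e → Derivation k (ResidueField S) (ResidueField S))
      (dx : Fin c → Derivation k S S) (du : Fin e → Derivation k S S),
      Subfield.closure (Set.range (fun y : ResidueField S => y ^ p) ∪ Set.range (fun j => residue S (u j))) = ⊤ ∧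
      (∀ j j', δ j (residue S (u j')) = if j' = j then 1 else 0) ∧
      (∀ y : ResidueField S, (∀ j, δ j y = 0) ↔ ∃ t, t ^ p = y) ∧
      (∀ i i', dx i (x i') = if i' = i then 1 else 0) ∧ (∀ i j, dx i (u j) = 0) ∧
      (∀ j i, du j (x i) = 0) ∧ (∀ j j', du j (u j') = if j' = j then 1 else 0) := by
  obtain ⟨e, u, δ, hu, hδ, hker⟩ := exists_residue_pBasis p k S
  obtain ⟨dx, du, h1, h2, h3, h4⟩ := exists_dual_derivations k S hc x hx u δ hδ
  exact ⟨e, u, δ, dx, du, hu, hδ, hker, h1, h2, h3, h4⟩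

/-- **The `u`-directions are logarithmic**: in the frame of `exists_frame`, `du_j 𝔪 ⊆ 𝔪` (they kill the parameters
generating `𝔪`). Stated for any derivation killing a generating family of `𝔪`. [folklore] -/
theorem derivation_map_maximalIdeal_le {k S : Type u} [Field k] [CommRing S] [IsLocalRing S] [Algebra k S]
    {c : ℕ} (x : Fin c → S) (hx : Ideal.span (Set.range x) = maximalIdeal S) (D : Derivation k S S)
    (hD : ∀ i, D (x i) = 0) {a : S} (ha : a ∈ maximalIdeal S) : D a ∈ maximalIdeal S :=
  derivation_map_le_of_apply_mem x _ hx D (fun i => by rw [hD]; exact zero_mem _) ha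

/-- **`ℤ`-form of the frame** (Matsumura's `Der(S) = Der_ℤ(S)`, the currency of §σ2.26's `H`): same statement with
`Derivation ℤ`. [cite: Matsumura1987, Thm. 30.6 (ii); §26 Thm. 26.5] [folklore] -/
theorem exists_frame_int (k S : Type u) [Field k] [CharP k p] [PerfectField k] [CommRing S]
    [IsRegularLocalRing S] [Algebra k S] [Algebra.EssFiniteType k S] {c : ℕ}
    (hc : (maximalIdeal S).spanFinrank = c) (x : Fin c → S) (hx : Ideal.span (Set.range x) = maximalIdeal S) :
    ∃ (e : ℕ) (u : Fin e → S) (δ : Fin e → Derivation ℤ (ResidueField S) (ResidueField S))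
      (dx : Fin c → Derivation ℤ S S) (du : Fin e → Derivation ℤ S S),
      Subfield.closure (Set.range (fun y : ResidueField S => y ^ p) ∪ Set.range (fun j => residue S (u j))) = ⊤ ∧
      (∀ j j', δ j (residue S (u j')) = if j' = j then 1 else 0) ∧
      (∀ y : ResidueField S, (∀ j, δ j y = 0) ↔ ∃ t, t ^ p = y) ∧
      (∀ i i', dx i (x i') = if i' = i then 1 else 0) ∧ (∀ i j, dx i (u j) = 0) ∧
      (∀ j i, du j (x i) = 0) ∧ (∀ j j', du j (u j') = if j' = j then 1 else 0) := by
  obtain ⟨e, u, δ, dx, du, h1, h2, h3, h4, h5, h6, h7⟩ := exists_frame p k S hc x hx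
  exact ⟨e, u, fun j => (δ j).restrictScalars ℤ, fun i => (dx i).restrictScalars ℤ,
    fun j => (du j).restrictScalars ℤ, h1, h2, h3, h4, h5, h6, h7⟩

/-- **Fully existential form**: a regular local ring essentially of finite type over a perfect field of characteristic
`p` HAS an 𝔪-adapted derivation frame (some regular system of parameters `x : Fin c → S`, `c = emb dim S`, plus
the data of `exists_frame_int`). [cite: Matsumura1987, Thm. 30.6 (ii); §26 Thm. 26.5] [folklore] -/
theorem exists_rsop_frame_int (k S : Type u) [Field k] [CharP k p] [PerfectField k] [CommRing S]
    [IsRegularLocalRing S] [Algebra k S] [Algebra.EssFiniteType k S] :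
    ∃ (c e : ℕ) (x : Fin c → S) (u : Fin e → S) (δ : Fin e → Derivation ℤ (ResidueField S) (ResidueField S))
      (dx : Fin c → Derivation ℤ S S) (du : Fin e → Derivation ℤ S S),
      (maximalIdeal S).spanFinrank = c ∧ Ideal.span (Set.range x) = maximalIdeal S ∧
      Subfield.closure (Set.range (fun y : ResidueField S => y ^ p) ∪ Set.range (fun j => residue S (u j))) = ⊤ ∧
      (∀ j j', δ j (residue S (u j')) = if j' = j then 1 else 0) ∧
      (∀ y : ResidueField S, (∀ j, δ j y = 0) ↔ ∃ t, t ^ p = y) ∧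
      (∀ i i', dx i (x i') = if i' = i then 1 else 0) ∧ (∀ i j, dx i (u j) = 0) ∧
      (∀ j i, du j (x i) = 0) ∧ (∀ j j', du j (u j') = if j' = j then 1 else 0) := by
  classical
  obtain ⟨s, hs, hspan⟩ := Submodule.FG.exists_span_finset_card_eq_spanFinrank
    (maximalIdeal S).fg_of_isNoetherianRing
  let ε := (Finset.equivFinOfCardEq hs).symm
  let x : Fin (maximalIdeal S).spanFinrank → S := fun i => ((ε i : s) : S)
  have hrange : Set.range x = ↑s := by
    ext y
    constructor
    · rintro ⟨i, rfl⟩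
      exact (ε i).2
    · intro hy
      exact ⟨ε.symm ⟨y, hy⟩, by simp [x]⟩
  have hx : Ideal.span (Set.range x) = maximalIdeal S := by rw [hrange]; exact hspan
  obtain ⟨e, u, δ, dx, du, h⟩ := exists_frame_int p k S rfl x hx
  exact ⟨_, e, x, u, δ, dx, du, rfl, hx, h⟩

end Frame

end Summit.ResolutionOfSingularities.ResolutionOfSingularities.Theorems.SwitchingDichotomy.MemberDerivationFrame

end
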